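import Summits.NavierStokesRegularity.OSWSelfSimilar.SheetRLinearisedRenewalEven
import Summits.NavierStokesRegularity.OSWSelfSimilar.SheetRRenewalScalarRate
import Summits.NavierStokesRegularity.OSWSelfSimilar.SheetRSpectrumStepRule
import Literature.Analysis.UnboundedOperators.RankOneMildRenewalRate
import Literature.Analysis.UnboundedOperators.RankOneKernelRegularity
import HarnessLib

/-!
# SHEET-ℝ, Z3-SR-SPEC EVEN half: «LINEARLY STABLE MODULO TRANSLATION» for the linearised flow on the even zero-mass class — the renewal route composed
# end to end, ABSTRACT HALF (the even twin IN TIER of `SheetRLinearisedStability`)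

HONEST FRAMING (cell ns-blowup GROUP B / zone Z3, case Z3-SR-SPEC EVEN half, HYPOTHESIS-LEDGER v2.3 row (P10)⁺; renewal route of memo
`HOME/profile/cert/cert5/P9-P10-RENEWAL-DESIGN.md` v2: (R-a)/(R-d) `SheetRLinearisedRenewalEven`, (R-b)/(R-c) AT A GENERAL SIMPLE REAL ZERO `SheetRRenewalScalarRate`
(time rescaling of `SheetRRenewalScalar`), (R-e) at rate `a` `Literature/Analysis/UnboundedOperators/RankOneMildRenewalRate`, (r1) `RankOneKernelRegularity`; 0 kit;
1-D MODEL certificate frame (viscous gCLM/OSW sheet on the line); not Euler/NS; «violates: none — MODEL»). NOTHING here asserts that a hypothesis holds.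

WHY NOT A MECHANICAL TWIN. On the odd class the Evans function's simple zero of record is the gauge mode `σ = 1`, hard-wired in the odd word's bricks; on the
even zero-mass class `E⁺₀` the zero of record is the TRANSLATION MODE `σ = 1/2` (`SheetRSpectrumEvenEndToEnd.eigen_half_simple_of_record`). The theorems of §1
are therefore stated at an ARBITRARY simple real zero `a > 0`; §2 specialises to `a = 1/2`.

THE THEOREM (`flow_sub_mode_le` / `flow_sub_mode_le'`). Let `h : GardingDataKE …` be the (S1⁺) datum on the even zero-mass class (`T⁺ = generatorEven`), let
`S`, `S_F` be C₀-semigroups on `WcevenZ hL` with the generator data of `SheetRLinearisedSemigroupEven.exists_c0SemigroupE` (`S.generator = T⁺`, `‖S(τ)‖ ≤ e^{−mτ}`,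
Laplace `= resolventEven`) and `….exists_c0Semigroup_fullE` (`D(S_F.generator) = D(T⁺)`, `S_F.generator = T⁺ + θℓ(·)f`), assume `f ∈ D(T⁺)` (or, §2, the even
far-field datum `MixedFarDatum (resolventEven …) hh f z …` of the spectral word, which contains it), and let `E⁺ = evansEven hL K h ℓ f θ` have NO zero in
`{Re σ > −β₀} ∖ {a}` and a SIMPLE zero at `a` (`0 < a`, `0 < β₀ ≤ m`). Then for every `0 < β′ < β₀` there is `M` with, for ALL data `δ₀` and `t ≥ 0`,
    `‖S_F(t)δ₀ − (θℓ(R⁺_K(a)δ₀)/E⁺′(a))·e^{at}·R⁺_K(a)f‖ ≤ M‖δ₀‖e^{−β′t}`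
— every orbit of the linearised even flow is the growing mode `e^{at}·R⁺_K(a)f` with the «adjoint pairing» coefficient plus a remainder decaying at rate `β′`.
§2 (`flow_sub_translationMode_le`, `flow_decay_of_orthogonalE`, `flow_sub_translationMode_le_of_mixedFarDatum`): the word at `a = 1/2`, «LINEARLY STABLE MODULO
TRANSLATION (MODEL, steady linearisation, even class, abstract half)», as ONE kernel theorem modulo {(S1⁺) datum, (P9)⁺ generator data, `f ∈ D(T⁺)` / far-field
datum, the three Evans sentences at `1/2`}. WHAT THIS IS NOT: not NS; no interval arithmetic; no composition with the even spectral word of record (cert lane); the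
semigroups, `f ∈ D(T⁺)` and the Evans sentences are HYPOTHESES; no number of record moves. No definition, no named fact.
-/

noncomputable section

namespace Summit.NavierStokesRegularity.OSWSelfSimilar
namespace SheetRLinearisedStabilityEven

open _root_.MeasureTheory _root_.Set _root_.Filter _root_.Complex SheetREnergySpace SheetRComplexPivot SheetREvenEnergySpace SheetREvenForms
  SheetREvenClass SheetRResolventEvenClass SheetRGeneratorEvenWeak SheetREvansEven SheetRLinearisedSemigroup SheetRLinearisedSemigroupEven
  SheetRLinearisedRenewalEven SheetRSpectrumStepRule
  Literature.Analysis.OperatorTheory Literature.Analysis.UnboundedOperators Literature.Analysis.Complex Literature.Analysis.Convolution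
open scoped Topology NNReal

variable {L D₀ D₁ V₀ c m : ℝ} {d V : ℝ → ℝ}

/-! ### §0 One exponential tail -/

/-- `‖∫₀^∞ e^{−as}m₀(s) ds‖ ≤ C₀/(a + μ)` when `‖m₀(s)‖ ≤ C₀e^{−μs}` on `s ≥ 0` and `a + μ > 0`. [folklore] -/
private theorem norm_integral_Ioi_exp_mul_le_rate {m₀ : ℝ → ℂ} (hm₀ : Continuous m₀) {C₀ μ a : ℝ} (hμ : 0 < a + μ)
    (hb : ∀ s, 0 ≤ s → ‖m₀ s‖ ≤ C₀ * Real.exp (-μ * s)) :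
    ‖∫ s in Ioi (0 : ℝ), (Real.exp (-(a * s)) : ℂ) * m₀ s‖ ≤ C₀ / (a + μ) := by
  have hdom : IntegrableOn (fun s => C₀ * Real.exp (-(a + μ) * s)) (Ioi (0 : ℝ)) :=
    (integrableOn_exp_mul_Ioi (a := -(a + μ)) (by linarith) 0).const_mul C₀
  have hle : ∀ s ∈ Ioi (0 : ℝ), ‖(Real.exp (-(a * s)) : ℂ) * m₀ s‖ ≤ C₀ * Real.exp (-(a + μ) * s) := by
    intro s hs
    rw [norm_mul, Complex.norm_real, Real.norm_of_nonneg (Real.exp_pos _).le]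
    calc Real.exp (-(a * s)) * ‖m₀ s‖ ≤ Real.exp (-(a * s)) * (C₀ * Real.exp (-μ * s)) :=
          mul_le_mul_of_nonneg_left (hb s (le_of_lt hs)) (Real.exp_pos _).le
      _ = C₀ * Real.exp (-(a + μ) * s) := by
          rw [show -(a + μ) * s = -(a * s) + -μ * s by ring, Real.exp_add]; ring
  have hmeas : AEStronglyMeasurable (fun s => (Real.exp (-(a * s)) : ℂ) * m₀ s) (volume.restrict (Ioi (0 : ℝ))) :=
    ((Complex.continuous_ofReal.comp (Real.continuous_exp.comp (by fun_prop))).mul hm₀).aestronglyMeasurable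
  have hint : IntegrableOn (fun s => (Real.exp (-(a * s)) : ℂ) * m₀ s) (Ioi (0 : ℝ)) :=
    Integrable.mono' hdom hmeas ((ae_restrict_iff' measurableSet_Ioi).2 (Eventually.of_forall hle))
  have hval : ∫ s in Ioi (0 : ℝ), C₀ * Real.exp (-(a + μ) * s) = C₀ / (a + μ) := by
    rw [MeasureTheory.integral_const_mul, integral_exp_mul_Ioi (by linarith) 0, mul_zero, Real.exp_zero, neg_div_neg_eq]
    ring
  calc ‖∫ s in Ioi (0 : ℝ), (Real.exp (-(a * s)) : ℂ) * m₀ s‖ ≤ ∫ s in Ioi (0 : ℝ), ‖(Real.exp (-(a * s)) : ℂ) * m₀ s‖ :=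
        norm_integral_le_integral_norm _
    _ ≤ ∫ s in Ioi (0 : ℝ), C₀ * Real.exp (-(a + μ) * s) := setIntegral_mono_on hint.norm hdom measurableSet_Ioi hle
    _ = C₀ / (a + μ) := hval

/-! ### §1 The word at a general simple real zero `a > 0` of `E⁺` -/

/-- **«LINEARLY STABLE MODULO THE MODE AT `a`» (MODEL), vector form, even zero-mass class.** See the module docstring. [folklore] -/
theorem flow_sub_mode_le (hL : 0 < L) (K : EspE L hL →L[ℝ] W L) (h : GardingDataKE L hL d V K D₀ D₁ V₀ c m)
    {σ₀ : ℂ} (hσ₀ : -m < σ₀.re) (hm : 0 < m)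
    (ℓ : WcevenZ hL →L[ℂ] ℂ) (f : WcevenZ hL) (θ : ℂ) (S SF : C0Semigroup ℂ (WcevenZ hL))
    (hS : S.generator = generatorEven hL K h σ₀ hσ₀) (hSM : ∀ τ : ℝ≥0, ‖S.app τ‖ ≤ Real.exp (-m * τ))
    (hlap : ∀ σ : ℂ, -m < σ.re → ∀ G : WcevenZ hL, S.laplaceResolventFun σ G = resolventEven hL K h σ G)
    (hdomF : (SF.generator.domain : Set (WcevenZ hL)) = (generatorEven hL K h σ₀ hσ₀).domain)
    (hgenF : ∀ (u : WcevenZ hL) (hu : u ∈ (generatorEven hL K h σ₀ hσ₀).domain), ∃ hu' : u ∈ SF.generator.domain,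
      SF.generator ⟨u, hu'⟩ = generatorEven hL K h σ₀ hσ₀ ⟨u, hu⟩ + (θ * ℓ u) • f)
    (hf : f ∈ (generatorEven hL K h σ₀ hσ₀).domain)
    {a β₀ β' : ℝ} (ha : 0 < a) (hβ₀ : 0 < β₀) (hβ₀m : β₀ ≤ m) (hβ' : 0 < β') (hβ'β₀ : β' < β₀)
    (hzero : ∀ σ : ℂ, -β₀ < σ.re → σ ≠ a → evansEven hL K h ℓ f θ σ ≠ 0)
    (hEa : evansEven hL K h ℓ f θ a = 0) (hE'a : deriv (evansEven hL K h ℓ f θ) a ≠ 0) :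
    ∃ M : ℝ, ∀ (δ₀ : WcevenZ hL) (t : ℝ), 0 ≤ t →
      ‖SF.app t.toNNReal δ₀ -
        ((deriv (evansEven hL K h ℓ f θ) a)⁻¹ *
            (∫ s in Ioi (0 : ℝ), (Real.exp (-(a * s)) : ℂ) * (θ * ℓ (S.app s.toNNReal δ₀))) * (Real.exp (a * t) : ℂ)) •
          S.laplaceResolventFun a f‖ ≤ M * ‖δ₀‖ * Real.exp (-β' * t) := by
  haveI : CompleteSpace (WcevenZ hL) := completeSpace_WcevenZ hL
  set E : ℂ → ℂ := evansEven hL K h ℓ f θ with hEdef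
  -- the kernel `k(τ) = θℓ(S(τ)f)` and its regularity from `f ∈ D(T⁺)` ((r1) via `RankOneKernelRegularity`)
  have hfS : f ∈ S.generator.domain := by rw [hS]; exact hf
  set fd : S.generator.domain := ⟨f, hfS⟩ with hfd
  obtain ⟨hk, hk', hd⟩ := S.renewalKernel_fields (θ • ℓ) hSM fd
  -- the symbol is the even Evans function ((R-d))
  have hE : ∀ s : ℂ, -m < s.re → E s = 1 - laplaceC (fun τ : ℝ => (θ • ℓ) (S.app (Real.toNNReal τ) (fd : WcevenZ hL))) s := by
    intro s hs
    have h1 := laplace_kernel_eq_one_sub_evansEven hL K h ℓ f θ S hSM hlap hs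
    have h2 : laplaceC (fun τ : ℝ => (θ • ℓ) (S.app (Real.toNNReal τ) (fd : WcevenZ hL))) s = 1 - E s := by
      rw [← h1, laplaceC]
      rfl
    rw [h2]; ring
  -- the uniform scalar theorem at the simple real zero `a`
  obtain ⟨N', hN'0, hN'⟩ := SheetRRenewalScalarRate.exists_uniform_renewal_const_rate ha hk hk' hd hm hE hβ₀ hβ₀m hzero hEa hE'a
    hβ' hβ'β₀
  set P : ℝ := ‖(deriv E a)⁻¹‖ with hP
  set A : ℝ := ‖θ‖ * ‖ℓ‖ with hA
  have hA0 : 0 ≤ A := by positivity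
  have hP0 : 0 ≤ P := norm_nonneg _
  have ham : 0 < a + m := by linarith
  have hmβ : 0 < m - β' := by linarith
  -- the constant
  refine ⟨1 + A * (1 + P / (a + m) + N') * ‖f‖ / (m - β') + P * (A / (a + m)) * ‖f‖ / (a + m), fun δ₀ t ht => ?_⟩
  -- the datum and the amplitude
  set m₀ : ℝ → ℂ := fun τ => θ * ℓ (S.app τ.toNNReal δ₀) with hm₀def
  set mm : ℝ → ℂ := fun τ => θ * ℓ (SF.app τ.toNNReal δ₀) with hmmdef
  have hm₀c : Continuous m₀ := continuous_const.mul (ℓ.continuous.comp (S.continuous_app_toNNReal δ₀))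
  have hmmc : Continuous mm := continuous_const.mul (ℓ.continuous.comp (SF.continuous_app_toNNReal δ₀))
  have hb₀ : ∀ s : ℝ, 0 ≤ s → ‖m₀ s‖ ≤ A * ‖δ₀‖ * Real.exp (-m * s) := by
    intro s hs
    have := norm_forcing_le_sheetE ℓ θ S hSM δ₀ s.toNNReal
    rw [Real.coe_toNNReal s hs] at this
    simpa [hm₀def, hA, mul_assoc] using this
  have hren : ∀ t : ℝ, 0 ≤ t → mm t = m₀ t + hconv (fun τ : ℝ => (θ • ℓ) (S.app (Real.toNNReal τ) (fd : WcevenZ hL))) mm t := by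
    intro t ht
    have := renewal_equation_sheetE hL K h hσ₀ ℓ f θ S SF hS hdomF hgenF δ₀ ht
    rw [hmmdef, hm₀def, hconv]
    simpa only [_root_.smul_apply, smul_eq_mul] using this
  have hscalar := hN' m₀ mm (A * ‖δ₀‖) m hm₀c hb₀ hmmc hren (by linarith)
  -- the scalar coefficient and its bound
  set c₁ : ℂ := (deriv E a)⁻¹ * ∫ s in Ioi (0 : ℝ), (Real.exp (-(a * s)) : ℂ) * m₀ s with hc₁
  have hI : ‖∫ s in Ioi (0 : ℝ), (Real.exp (-(a * s)) : ℂ) * m₀ s‖ ≤ A * ‖δ₀‖ / (a + m) :=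
    norm_integral_Ioi_exp_mul_le_rate hm₀c ham hb₀
  have hc₁le : ‖c₁‖ ≤ P * (A * ‖δ₀‖ / (a + m)) := by
    rw [hc₁, norm_mul]; exact mul_le_mul_of_nonneg_left hI hP0
  -- scalar decay in the shape `‖θℓ(S_F(s)δ₀) − c₁e^{as}‖ ≤ M_δ e^{−β′s}`
  set Mδ : ℝ := A * ‖δ₀‖ * (1 + P / (a + m) + N') with hMδ
  have hsc : ∀ s : ℝ, 0 ≤ s → ‖(θ • ℓ) (SF.app s.toNNReal δ₀) - c₁ * cexp ((a : ℂ) * s)‖ ≤ Mδ * Real.exp (-β' * s) := by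
    intro s hs
    have h1 := hscalar s hs
    have h2 : (θ • ℓ) (SF.app s.toNNReal δ₀) - c₁ * cexp ((a : ℂ) * s) =
        mm s - (deriv E a)⁻¹ * (∫ s in Ioi (0 : ℝ), (Real.exp (-(a * s)) : ℂ) * m₀ s) * (Real.exp (a * s) : ℂ) := by
      rw [hmmdef, hc₁, Complex.ofReal_exp, _root_.smul_apply, smul_eq_mul]
      push_cast
      ring
    rw [h2]; exact h1
  -- the mild form of the flow
  have hmild : ∀ t : ℝ, 0 ≤ t → SF.app t.toNNReal δ₀ = S.app (Real.toNNReal t) δ₀ +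
      ∫ s in (0 : ℝ)..t, S.app (Real.toNNReal (t - s)) ((θ • ℓ) (SF.app s.toNNReal δ₀) • f) := by
    intro t ht
    rw [flow_eq_add_integral_sheetE hL K h hσ₀ ℓ f θ S SF hS hdomF hgenF δ₀ ht]
    congr 1
    refine intervalIntegral.integral_congr fun s _ => ?_
    simp only [ContinuousLinearMap.map_smul, _root_.smul_apply, smul_eq_mul]
  -- the vector theorem at rate `a`
  have hvec := C0Semigroup.norm_mild_sub_mode_le_rate (S := S) (ℓ := θ • ℓ) (f := f) (u₀ := δ₀)
    (u := fun t : ℝ => SF.app t.toNNReal δ₀) hSM ham (SF.continuous_app_toNNReal δ₀) hmild (by linarith) hsc ht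
  have hcoef : c₁ * cexp ((a : ℂ) * t) =
      (deriv E a)⁻¹ * (∫ s in Ioi (0 : ℝ), (Real.exp (-(a * s)) : ℂ) * m₀ s) * (Real.exp (a * t) : ℂ) := by
    rw [hc₁, Complex.ofReal_exp]
    push_cast
    ring
  rw [hcoef] at hvec
  refine hvec.trans ?_
  -- collect the constant: every term is `≤ (…)·‖δ₀‖·e^{−β′t}`
  have hexp : 0 < Real.exp (-β' * t) := Real.exp_pos _
  have hδ : 0 ≤ ‖δ₀‖ := norm_nonneg _
  have hf0 : 0 ≤ ‖f‖ := norm_nonneg _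
  have ht1 : Mδ * ‖f‖ / (m - β') = (A * (1 + P / (a + m) + N') * ‖f‖ / (m - β')) * ‖δ₀‖ := by
    rw [hMδ]; field_simp
  have ht2 : ‖c₁‖ * ‖f‖ / (a + m) ≤ (P * (A / (a + m)) * ‖f‖ / (a + m)) * ‖δ₀‖ := by
    have : ‖c₁‖ * ‖f‖ / (a + m) ≤ P * (A * ‖δ₀‖ / (a + m)) * ‖f‖ / (a + m) := by
      apply div_le_div_of_nonneg_right _ ham.le
      exact mul_le_mul_of_nonneg_right hc₁le hf0
    refine this.trans (le_of_eq ?_)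
    field_simp
  calc (‖δ₀‖ + Mδ * ‖f‖ / (m - β') + ‖c₁‖ * ‖f‖ / (a + m)) * Real.exp (-β' * t)
      ≤ (‖δ₀‖ + (A * (1 + P / (a + m) + N') * ‖f‖ / (m - β')) * ‖δ₀‖ +
          (P * (A / (a + m)) * ‖f‖ / (a + m)) * ‖δ₀‖) * Real.exp (-β' * t) := by
        refine mul_le_mul_of_nonneg_right ?_ hexp.le
        rw [ht1]; linarith [ht2]
    _ = (1 + A * (1 + P / (a + m) + N') * ‖f‖ / (m - β') + P * (A / (a + m)) * ‖f‖ / (a + m)) * ‖δ₀‖ *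
          Real.exp (-β' * t) := by ring

/-- **The adjoint pairing as a resolvent value**: `∫₀^∞ e^{−as}·θℓ(S(s)G) ds = θℓ(R⁺_K(a)G)` (Laplace bridge at `σ = a`, `ℓ` through the Bochner integral;
`a + m > 0`). [folklore] -/
theorem integral_exp_neg_mul_apply_eqE (hL : 0 < L) (K : EspE L hL →L[ℝ] W L) (h : GardingDataKE L hL d V K D₀ D₁ V₀ c m)
    (ℓ : WcevenZ hL →L[ℂ] ℂ) (θ : ℂ) (S : C0Semigroup ℂ (WcevenZ hL)) (hSM : ∀ τ : ℝ≥0, ‖S.app τ‖ ≤ Real.exp (-m * τ))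
    (hlap : ∀ σ : ℂ, -m < σ.re → ∀ G : WcevenZ hL, S.laplaceResolventFun σ G = resolventEven hL K h σ G) {a : ℝ} (ha : 0 < a + m)
    (G : WcevenZ hL) :
    ∫ s in Ioi (0 : ℝ), (Real.exp (-(a * s)) : ℂ) * (θ * ℓ (S.app s.toNNReal G)) = θ * ℓ (resolventEven hL K h a G) := by
  haveI : CompleteSpace (WcevenZ hL) := completeSpace_WcevenZ hL
  have h1 : -m < (a : ℂ).re := by simp; linarith
  have hM' : ∀ t : ℝ≥0, ‖S.app t‖ ≤ 1 * Real.exp (-m * t) := fun t => by rw [one_mul]; exact hSM t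
  have hint := C0Semigroup.integrableOn_integrand S hM' (l := a) (by simp; linarith) G
  have hcomm := ((θ • ℓ).integral_comp_comm hint)
  have hcongr : (fun τ : ℝ => (θ • ℓ) (Complex.exp (-((a : ℂ) * (τ : ℂ))) • S.app (Real.toNNReal τ) G)) =
      fun τ : ℝ => (Real.exp (-(a * τ)) : ℂ) * (θ * ℓ (S.app (Real.toNNReal τ) G)) := by
    funext τ
    rw [map_smul, _root_.smul_apply, smul_eq_mul, smul_eq_mul, Complex.ofReal_exp]
    push_cast
    ring
  rw [hcongr] at hcomm
  have hdef : (∫ τ in Ioi (0 : ℝ), Complex.exp (-((a : ℂ) * (τ : ℂ))) • S.app (Real.toNNReal τ) G) = S.laplaceResolventFun a G := rfl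
  rw [hcomm, _root_.smul_apply, smul_eq_mul, hdef, hlap a h1 G]

/-- **«LINEARLY STABLE MODULO THE MODE AT `a`» (MODEL), resolvent form of the coefficient and of the mode**: for all `δ₀`, `t ≥ 0`,
`‖S_F(t)δ₀ − (θℓ(R⁺_K(a)δ₀)/E⁺′(a))·e^{at}·R⁺_K(a)f‖ ≤ M‖δ₀‖e^{−β′t}` — the growing direction is the resolvent vector `R⁺_K(a)f` (the eigenvector of `T⁺ + θℓ(·)f`
at `a` when `E⁺(a) = 0`) and the coefficient is the left-eigenvector pairing `θℓ(R⁺_K(a)·)/E⁺′(a)`. Same hypotheses as `flow_sub_mode_le`. [folklore] -/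
theorem flow_sub_mode_le' (hL : 0 < L) (K : EspE L hL →L[ℝ] W L) (h : GardingDataKE L hL d V K D₀ D₁ V₀ c m)
    {σ₀ : ℂ} (hσ₀ : -m < σ₀.re) (hm : 0 < m)
    (ℓ : WcevenZ hL →L[ℂ] ℂ) (f : WcevenZ hL) (θ : ℂ) (S SF : C0Semigroup ℂ (WcevenZ hL))
    (hS : S.generator = generatorEven hL K h σ₀ hσ₀) (hSM : ∀ τ : ℝ≥0, ‖S.app τ‖ ≤ Real.exp (-m * τ))
    (hlap : ∀ σ : ℂ, -m < σ.re → ∀ G : WcevenZ hL, S.laplaceResolventFun σ G = resolventEven hL K h σ G)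
    (hdomF : (SF.generator.domain : Set (WcevenZ hL)) = (generatorEven hL K h σ₀ hσ₀).domain)
    (hgenF : ∀ (u : WcevenZ hL) (hu : u ∈ (generatorEven hL K h σ₀ hσ₀).domain), ∃ hu' : u ∈ SF.generator.domain,
      SF.generator ⟨u, hu'⟩ = generatorEven hL K h σ₀ hσ₀ ⟨u, hu⟩ + (θ * ℓ u) • f)
    (hf : f ∈ (generatorEven hL K h σ₀ hσ₀).domain)
    {a β₀ β' : ℝ} (ha : 0 < a) (hβ₀ : 0 < β₀) (hβ₀m : β₀ ≤ m) (hβ' : 0 < β') (hβ'β₀ : β' < β₀)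
    (hzero : ∀ σ : ℂ, -β₀ < σ.re → σ ≠ a → evansEven hL K h ℓ f θ σ ≠ 0)
    (hEa : evansEven hL K h ℓ f θ a = 0) (hE'a : deriv (evansEven hL K h ℓ f θ) a ≠ 0) :
    ∃ M : ℝ, ∀ (δ₀ : WcevenZ hL) (t : ℝ), 0 ≤ t →
      ‖SF.app t.toNNReal δ₀ -
        ((deriv (evansEven hL K h ℓ f θ) a)⁻¹ * (θ * ℓ (resolventEven hL K h a δ₀)) * (Real.exp (a * t) : ℂ)) •
          resolventEven hL K h a f‖ ≤ M * ‖δ₀‖ * Real.exp (-β' * t) := by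
  have ham : 0 < a + m := by linarith
  obtain ⟨M, hM⟩ := flow_sub_mode_le hL K h hσ₀ hm ℓ f θ S SF hS hSM hlap hdomF hgenF hf ha hβ₀ hβ₀m hβ' hβ'β₀ hzero hEa hE'a
  refine ⟨M, fun δ₀ t ht => ?_⟩
  have h1 := hM δ₀ t ht
  rwa [integral_exp_neg_mul_apply_eqE hL K h ℓ θ S hSM hlap ham δ₀, hlap a (by simp; linarith) f] at h1

/-- **Decay on the adjoint-orthogonal hyperplane**: if `θℓ(R⁺_K(a)δ₀) = 0` (no component along the left eigenvector at `a`) then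
`‖S_F(t)δ₀‖ ≤ M‖δ₀‖e^{−β′t}`. [folklore] -/
theorem flow_decay_of_orthogonal_mode (hL : 0 < L) (K : EspE L hL →L[ℝ] W L) (h : GardingDataKE L hL d V K D₀ D₁ V₀ c m)
    {σ₀ : ℂ} (hσ₀ : -m < σ₀.re) (hm : 0 < m)
    (ℓ : WcevenZ hL →L[ℂ] ℂ) (f : WcevenZ hL) (θ : ℂ) (S SF : C0Semigroup ℂ (WcevenZ hL))
    (hS : S.generator = generatorEven hL K h σ₀ hσ₀) (hSM : ∀ τ : ℝ≥0, ‖S.app τ‖ ≤ Real.exp (-m * τ))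
    (hlap : ∀ σ : ℂ, -m < σ.re → ∀ G : WcevenZ hL, S.laplaceResolventFun σ G = resolventEven hL K h σ G)
    (hdomF : (SF.generator.domain : Set (WcevenZ hL)) = (generatorEven hL K h σ₀ hσ₀).domain)
    (hgenF : ∀ (u : WcevenZ hL) (hu : u ∈ (generatorEven hL K h σ₀ hσ₀).domain), ∃ hu' : u ∈ SF.generator.domain,
      SF.generator ⟨u, hu'⟩ = generatorEven hL K h σ₀ hσ₀ ⟨u, hu⟩ + (θ * ℓ u) • f)
    (hf : f ∈ (generatorEven hL K h σ₀ hσ₀).domain)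
    {a β₀ β' : ℝ} (ha : 0 < a) (hβ₀ : 0 < β₀) (hβ₀m : β₀ ≤ m) (hβ' : 0 < β') (hβ'β₀ : β' < β₀)
    (hzero : ∀ σ : ℂ, -β₀ < σ.re → σ ≠ a → evansEven hL K h ℓ f θ σ ≠ 0)
    (hEa : evansEven hL K h ℓ f θ a = 0) (hE'a : deriv (evansEven hL K h ℓ f θ) a ≠ 0) :
    ∃ M : ℝ, ∀ (δ₀ : WcevenZ hL), θ * ℓ (resolventEven hL K h a δ₀) = 0 → ∀ t : ℝ, 0 ≤ t →
      ‖SF.app t.toNNReal δ₀‖ ≤ M * ‖δ₀‖ * Real.exp (-β' * t) := by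
  obtain ⟨M, hM⟩ := flow_sub_mode_le' hL K h hσ₀ hm ℓ f θ S SF hS hSM hlap hdomF hgenF hf ha hβ₀ hβ₀m hβ' hβ'β₀ hzero hEa hE'a
  refine ⟨M, fun δ₀ horth t ht => ?_⟩
  have h1 := hM δ₀ t ht
  rwa [horth, mul_zero, zero_mul, zero_smul, sub_zero] at h1

/-! ### §2 The word at the translation mode `a = 1/2`, and `f ∈ D(T⁺)` from the even far-field datum -/

/-- **«LINEARLY STABLE MODULO TRANSLATION» (MODEL, steady linearisation, even class, abstract half).** Hypotheses: (S1⁺) datum `h`, (P9)⁺ generator data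
(`S`, `S_F` as in `SheetRLinearisedSemigroupEven`), `f ∈ D(T⁺)`, and the three even Evans sentences AT `σ = 1/2`: `E⁺ ≠ 0` on `{Re σ > −β₀} ∖ {1/2}`, `E⁺(1/2) = 0`,
`E⁺′(1/2) ≠ 0` (`0 < β′ < β₀ ≤ m`). Conclusion: for all `δ₀`, `t ≥ 0`,
`‖S_F(t)δ₀ − (θℓ(R⁺_K(1/2)δ₀)/E⁺′(1/2))·e^{t/2}·R⁺_K(1/2)f‖ ≤ M‖δ₀‖e^{−β′t}` — the linearised even flow is `c(δ₀)·e^{t/2}·(translation mode direction)` plus a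
remainder decaying at rate `β′`. 1-D MODEL; NOT NS; the Evans sentences are EXPLICIT binders, nothing of record is discharged here. [folklore] -/
theorem flow_sub_translationMode_le (hL : 0 < L) (K : EspE L hL →L[ℝ] W L) (h : GardingDataKE L hL d V K D₀ D₁ V₀ c m)
    {σ₀ : ℂ} (hσ₀ : -m < σ₀.re) (hm : 0 < m)
    (ℓ : WcevenZ hL →L[ℂ] ℂ) (f : WcevenZ hL) (θ : ℂ) (S SF : C0Semigroup ℂ (WcevenZ hL))
    (hS : S.generator = generatorEven hL K h σ₀ hσ₀) (hSM : ∀ τ : ℝ≥0, ‖S.app τ‖ ≤ Real.exp (-m * τ))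
    (hlap : ∀ σ : ℂ, -m < σ.re → ∀ G : WcevenZ hL, S.laplaceResolventFun σ G = resolventEven hL K h σ G)
    (hdomF : (SF.generator.domain : Set (WcevenZ hL)) = (generatorEven hL K h σ₀ hσ₀).domain)
    (hgenF : ∀ (u : WcevenZ hL) (hu : u ∈ (generatorEven hL K h σ₀ hσ₀).domain), ∃ hu' : u ∈ SF.generator.domain,
      SF.generator ⟨u, hu'⟩ = generatorEven hL K h σ₀ hσ₀ ⟨u, hu⟩ + (θ * ℓ u) • f)
    (hf : f ∈ (generatorEven hL K h σ₀ hσ₀).domain)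
    {β₀ β' : ℝ} (hβ₀ : 0 < β₀) (hβ₀m : β₀ ≤ m) (hβ' : 0 < β') (hβ'β₀ : β' < β₀)
    (hzero : ∀ σ : ℂ, -β₀ < σ.re → σ ≠ 1 / 2 → evansEven hL K h ℓ f θ σ ≠ 0)
    (hEhalf : evansEven hL K h ℓ f θ (1 / 2) = 0) (hE'half : deriv (evansEven hL K h ℓ f θ) (1 / 2) ≠ 0) :
    ∃ M : ℝ, ∀ (δ₀ : WcevenZ hL) (t : ℝ), 0 ≤ t →
      ‖SF.app t.toNNReal δ₀ -
        ((deriv (evansEven hL K h ℓ f θ) (1 / 2))⁻¹ * (θ * ℓ (resolventEven hL K h (1 / 2) δ₀)) * (Real.exp (t / 2) : ℂ)) •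
          resolventEven hL K h (1 / 2) f‖ ≤ M * ‖δ₀‖ * Real.exp (-β' * t) := by
  have hhalf : (((1 / 2 : ℝ)) : ℂ) = 1 / 2 := by push_cast; ring
  have hzero' : ∀ σ : ℂ, -β₀ < σ.re → σ ≠ ((1 / 2 : ℝ) : ℂ) → evansEven hL K h ℓ f θ σ ≠ 0 := by
    rw [hhalf]; exact hzero
  have hEa : evansEven hL K h ℓ f θ ((1 / 2 : ℝ) : ℂ) = 0 := by rw [hhalf]; exact hEhalf
  have hE'a : deriv (evansEven hL K h ℓ f θ) ((1 / 2 : ℝ) : ℂ) ≠ 0 := by rw [hhalf]; exact hE'half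
  obtain ⟨M, hM⟩ := flow_sub_mode_le' hL K h hσ₀ hm ℓ f θ S SF hS hSM hlap hdomF hgenF hf (by norm_num : (0 : ℝ) < 1 / 2)
    hβ₀ hβ₀m hβ' hβ'β₀ hzero' hEa hE'a
  refine ⟨M, fun δ₀ t ht => ?_⟩
  have h1 := hM δ₀ t ht
  rwa [hhalf, show (1 / 2 : ℝ) * t = t / 2 by ring] at h1

/-- **Decay on the translation-adjoint-orthogonal hyperplane** (`a = 1/2`): if `θℓ(R⁺_K(1/2)δ₀) = 0` then `‖S_F(t)δ₀‖ ≤ M‖δ₀‖e^{−β′t}`. [folklore] -/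
theorem flow_decay_of_orthogonalE (hL : 0 < L) (K : EspE L hL →L[ℝ] W L) (h : GardingDataKE L hL d V K D₀ D₁ V₀ c m)
    {σ₀ : ℂ} (hσ₀ : -m < σ₀.re) (hm : 0 < m)
    (ℓ : WcevenZ hL →L[ℂ] ℂ) (f : WcevenZ hL) (θ : ℂ) (S SF : C0Semigroup ℂ (WcevenZ hL))
    (hS : S.generator = generatorEven hL K h σ₀ hσ₀) (hSM : ∀ τ : ℝ≥0, ‖S.app τ‖ ≤ Real.exp (-m * τ))
    (hlap : ∀ σ : ℂ, -m < σ.re → ∀ G : WcevenZ hL, S.laplaceResolventFun σ G = resolventEven hL K h σ G)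
    (hdomF : (SF.generator.domain : Set (WcevenZ hL)) = (generatorEven hL K h σ₀ hσ₀).domain)
    (hgenF : ∀ (u : WcevenZ hL) (hu : u ∈ (generatorEven hL K h σ₀ hσ₀).domain), ∃ hu' : u ∈ SF.generator.domain,
      SF.generator ⟨u, hu'⟩ = generatorEven hL K h σ₀ hσ₀ ⟨u, hu⟩ + (θ * ℓ u) • f)
    (hf : f ∈ (generatorEven hL K h σ₀ hσ₀).domain)
    {β₀ β' : ℝ} (hβ₀ : 0 < β₀) (hβ₀m : β₀ ≤ m) (hβ' : 0 < β') (hβ'β₀ : β' < β₀)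
    (hzero : ∀ σ : ℂ, -β₀ < σ.re → σ ≠ 1 / 2 → evansEven hL K h ℓ f θ σ ≠ 0)
    (hEhalf : evansEven hL K h ℓ f θ (1 / 2) = 0) (hE'half : deriv (evansEven hL K h ℓ f θ) (1 / 2) ≠ 0) :
    ∃ M : ℝ, ∀ (δ₀ : WcevenZ hL), θ * ℓ (resolventEven hL K h (1 / 2) δ₀) = 0 → ∀ t : ℝ, 0 ≤ t →
      ‖SF.app t.toNNReal δ₀‖ ≤ M * ‖δ₀‖ * Real.exp (-β' * t) := by
  obtain ⟨M, hM⟩ := flow_sub_translationMode_le hL K h hσ₀ hm ℓ f θ S SF hS hSM hlap hdomF hgenF hf hβ₀ hβ₀m hβ' hβ'β₀ hzero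
    hEhalf hE'half
  refine ⟨M, fun δ₀ horth t ht => ?_⟩
  have h1 := hM δ₀ t ht
  rwa [horth, mul_zero, zero_mul, zero_smul, sub_zero] at h1

/-- **`f ∈ D(T⁺)` from the even far-field datum.** The far-field hypothesis of the even spectral word (`SheetRSpectrumEvenAssembly.eigen_set_eq_singleton`:
`MixedFarDatum (resolventEven hL K h) hh f z B₁ B₂ G₁ G₁′`, i.e. `f = R⁺_K(z)(g₁ + z f)` for some `g₁`, plus adjoint data and four norms) already contains
`f ∈ D(generatorEven)`: `f` is a resolvent value. Hence the word asks NOTHING beyond the spectral word's hypotheses. The instance argument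
`[CompleteSpace (WcevenZ hL)]` (needed to state `MixedFarDatum`, which mentions an adjoint) is supplied by `SheetREvenClass.completeSpace_WcevenZ hL`. [folklore] -/
theorem mem_domain_generatorEven_of_mixedFarDatum (hL : 0 < L) [CompleteSpace (WcevenZ hL)] (K : EspE L hL →L[ℝ] W L)
    (h : GardingDataKE L hL d V K D₀ D₁ V₀ c m)
    {σ₀ : ℂ} (hσ₀ : -m < σ₀.re) {z : ℂ} (hz : -m < z.re) {hh f : WcevenZ hL} {B₁ B₂ G₁ G₁' : ℝ}
    (hF : MixedFarDatum (resolventEven hL K h) hh f z B₁ B₂ G₁ G₁') :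
    f ∈ (generatorEven hL K h σ₀ hσ₀).domain := by
  obtain ⟨g₁, -, hf, -⟩ := hF
  rw [hf]
  exact resolventEven_mem_domain hL K h hσ₀ hz _

/-- **«LINEARLY STABLE MODULO TRANSLATION» (MODEL) with the even far-field datum in place of `f ∈ D(T⁺)`.** Same conclusion as
`flow_sub_translationMode_le`; hypotheses = (S1⁺) datum + (P9)⁺ generator data + the even Evans sentences at `1/2` + a far-field datum
`MixedFarDatum (resolventEven …) hh f z …` (`Re z > −m`). 1-D MODEL; NOT NS. [folklore] -/
theorem flow_sub_translationMode_le_of_mixedFarDatum (hL : 0 < L) [CompleteSpace (WcevenZ hL)] (K : EspE L hL →L[ℝ] W L)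
    (h : GardingDataKE L hL d V K D₀ D₁ V₀ c m)
    {σ₀ : ℂ} (hσ₀ : -m < σ₀.re) (hm : 0 < m)
    (ℓ : WcevenZ hL →L[ℂ] ℂ) (f : WcevenZ hL) (θ : ℂ) (S SF : C0Semigroup ℂ (WcevenZ hL))
    (hS : S.generator = generatorEven hL K h σ₀ hσ₀) (hSM : ∀ τ : ℝ≥0, ‖S.app τ‖ ≤ Real.exp (-m * τ))
    (hlap : ∀ σ : ℂ, -m < σ.re → ∀ G : WcevenZ hL, S.laplaceResolventFun σ G = resolventEven hL K h σ G)
    (hdomF : (SF.generator.domain : Set (WcevenZ hL)) = (generatorEven hL K h σ₀ hσ₀).domain)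
    (hgenF : ∀ (u : WcevenZ hL) (hu : u ∈ (generatorEven hL K h σ₀ hσ₀).domain), ∃ hu' : u ∈ SF.generator.domain,
      SF.generator ⟨u, hu'⟩ = generatorEven hL K h σ₀ hσ₀ ⟨u, hu⟩ + (θ * ℓ u) • f)
    {z : ℂ} (hz : -m < z.re) {hh : WcevenZ hL} {B₁ B₂ G₁ G₁' : ℝ} (hF : MixedFarDatum (resolventEven hL K h) hh f z B₁ B₂ G₁ G₁')
    {β₀ β' : ℝ} (hβ₀ : 0 < β₀) (hβ₀m : β₀ ≤ m) (hβ' : 0 < β') (hβ'β₀ : β' < β₀)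
    (hzero : ∀ σ : ℂ, -β₀ < σ.re → σ ≠ 1 / 2 → evansEven hL K h ℓ f θ σ ≠ 0)
    (hEhalf : evansEven hL K h ℓ f θ (1 / 2) = 0) (hE'half : deriv (evansEven hL K h ℓ f θ) (1 / 2) ≠ 0) :
    ∃ M : ℝ, ∀ (δ₀ : WcevenZ hL) (t : ℝ), 0 ≤ t →
      ‖SF.app t.toNNReal δ₀ -
        ((deriv (evansEven hL K h ℓ f θ) (1 / 2))⁻¹ * (θ * ℓ (resolventEven hL K h (1 / 2) δ₀)) * (Real.exp (t / 2) : ℂ)) •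
          resolventEven hL K h (1 / 2) f‖ ≤ M * ‖δ₀‖ * Real.exp (-β' * t) :=
  flow_sub_translationMode_le hL K h hσ₀ hm ℓ f θ S SF hS hSM hlap hdomF hgenF
    (mem_domain_generatorEven_of_mixedFarDatum hL K h hσ₀ hz hF) hβ₀ hβ₀m hβ' hβ'β₀ hzero hEhalf hE'half

end SheetRLinearisedStabilityEven
end Summit.NavierStokesRegularity.OSWSelfSimilar

end
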